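import Literature.AlgebraicGeometry.Motives.AbelianVarietyIsogenyPullbackPushforwardCharts
import Literature.AlgebraicGeometry.Motives.AbelianVarietyQuotientChartInvariants
import HarnessLib

/-!
# `g^*(g_*F) ≅ ∐_{x ∈ Ker g(ℂ)} t_x^*F` for an isogeny of complex abelian varieties (the named fact holds)

Layer `Literature/AlgebraicGeometry/Motives`, namespace `Literature.AlgebraicGeometry.Motives.AbelianVariety`.
(Typing debt of cell `pub-hodge-ring2`, R13.62 (2): research route conditional on HC_CM; not a corollary;
Q11.4-sentence-2 already refuted in dim ≥ 3.)

`isogenyPullbackPushforwardDecomposition_holds : IsogenyPullbackPushforwardDecomposition` — Mumford, *Abelian Varieties*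
§7 Thm. 4 (p. 72) (a finite subgroup `Ker g` acts freely by translations and `B = A/Ker g`) with §12 Thm. 1 (descent along
the Galois covering `g`): for an isogeny `g : A → B` of complex abelian varieties and a vector bundle `F` on `A`,
**`g^*g_*F ≅ ∐_{x ∈ Ker g(ℂ)} t_x^*F`**. Assembled from the tree:

* `nonempty_pullback_pushforward_iso_sigma_of_galoisCharts` (`Literature.AlgebraicGeometry.Modules`, module
  Chase–Harrison–Rosenberg on the affine charts, Greither LNM 1534 Ch. 0 Thm. 1.6) reduces the decomposition to freeness of
  the kernel translations on the charts `g⁻¹V` (`chartFree_kerTranslation`) and the descent of invariant functions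
  `Γ(B, V) ↠ Γ(A, g⁻¹V)^{Ker g(ℂ)}` (`ChartInvariants`);
* every complex isogeny is `A → A/Ker g ≅ B` (`IsIsogeny.exists_torsionQuot_iso_comp_eq`), so it suffices to treat the
  tree's quotient maps `π : A → A/S` (`isogenyPullbackPushforwardDecomposition_of_torsionQuot_chartInvariants`);
* for those, `A/S = Spec_A((r_*𝒪_Y)^G)` and the invariant functions descend chart by chart
  (`exists_quotientMap_appLE_eq`, `chartInvariants_of_sections`).

## References

* [MumfordAV1970] D. Mumford, *Abelian Varieties* (1970), §7 Theorem p. 66 (2) and Thm. 4 (p. 72); §12 Thm. 1 (p. 111).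
* [Greither1992CyclicGalois] C. Greither, LNM 1534 (1992), Ch. 0 Thm. 1.6, Lemma 1.10.
* [GortzWedhorn2023] U. Görtz, T. Wedhorn, *Algebraic Geometry II* (2023), Prop. 27.62 (2), Thm. 27.68.
-/

noncomputable section

universe u

open CategoryTheory CategoryTheory.Limits AlgebraicGeometry TopologicalSpace

namespace Literature.AlgebraicGeometry.Motives

namespace AbelianVariety

open Literature.AlgebraicGeometry.Modules

/-- **`ChartInvariants` from a description of the sections over `W = g⁻¹V`**: if every `τ`-invariant section `c` of `X`
over an open `W = g⁻¹V` is `g♯ r` for some `r ∈ Γ(Y, V)`, then `ChartInvariants g τ _ V` (transport along `g⁻¹V = W`).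
[cite: Greither1992CyclicGalois, Ch. 0 Lemma 1.10 (p. 5)] -/
theorem chartInvariants_of_sections {X Y : Scheme.{u}} (g : X ⟶ Y) {K : Type u} (τ : K → (X ⟶ X))
    (hτ : ∀ x, τ x ≫ g = g) {V : Y.Opens} {W : X.Opens} (hW : g ⁻¹ᵁ V = W) (hle : ∀ x, W ≤ τ x ⁻¹ᵁ W)
    (h : ∀ c : Γ(X, W), (∀ x, (τ x).appLE W W (hle x) c = c) → ∃ r : Γ(Y, V), g.appLE V W hW.ge r = c) :
    ChartInvariants g τ hτ V := by
  subst hW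
  intro b hb
  obtain ⟨r, hr⟩ := h b fun x => hb x
  refine ⟨r, ?_⟩
  rw [Scheme.Hom.appLE_eq_app] at hr
  exact hr

/-- **The named fact `IsogenyPullbackPushforwardDecomposition` holds**: for an isogeny `g : A → B` of complex abelian
varieties and a finite locally free `𝒪_A`-module `F`, `g^*(g_*F) ≅ ∐_{x ∈ Ker g(ℂ)} t_x^*F` (Mumford §7 Thm. 4 with §12
Thm. 1; here: module Chase–Harrison–Rosenberg on the affine charts of `B = A/Ker g`).
[cite: MumfordAV1970, §7 Thm. 4 (p. 72) and §12 Thm. 1 (p. 111)] [cite: Greither1992CyclicGalois, Ch. 0 Thm. 1.6, Lemma 1.10] -/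
theorem isogenyPullbackPushforwardDecomposition_holds : IsogenyPullbackPushforwardDecomposition := by
  refine isogenyPullbackPushforwardDecomposition_of_torsionQuot_chartInvariants fun A n hn S hS y => ?_
  haveI := A.isAffineHom_toSchemeHom_zsmul_id hn
  haveI : Finite S := A.finite_of_le_torsionPoints hn hS
  have hSq : ∀ s ∈ S, s ≫ (((n : ℤ) • 𝟙 A :) ).hom.hom.hom = 1 := A.comp_zsmul_id_eq_one_of_le_torsionPoints hS
  -- the quotient datum `A/S = Y/G`, `Y = A_ℂ`, `G = S ⋊ Aut(ℂ/ℂ)`, `r = pr ≫ [n]`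
  let ρ := A.quotAction ℂ S (A.smul_mem_of_algEquiv_self S) ((n : ℤ) • 𝟙 A) hSq
  -- an affine chart `U ∋ (A/S → A)(y)` of `A` and the affine chart `(A/S → A)⁻¹U ∋ y` of `A/S`
  obtain ⟨U, hU, hyU, -⟩ := Opens.isBasis_iff_nbhd.mp A.X.left.isBasis_affineOpens
    (show ρ.quotientToBase.base y ∈ (⊤ : A.X.left.Opens) from trivial)
  refine ⟨ρ.quotientToBase ⁻¹ᵁ U, hyU, hU.preimage ρ.quotientToBase, ?_⟩
  -- the invariant functions on `[n]⁻¹U = π⁻¹((A/S → A)⁻¹U)` descend (`exists_quotientMap_appLE_eq`)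
  exact chartInvariants_of_sections _ _ _
    (A.quotientMap_preimage_quotientToBase_preimage S (A.smul_mem_of_algEquiv_self S) ((n : ℤ) • 𝟙 A) hSq U)
    (fun s => A.preimage_le_translation_preimage S ((n : ℤ) • 𝟙 A) hSq U s) fun c hc =>
      A.exists_quotientMap_appLE_eq S (A.smul_mem_of_algEquiv_self S) ((n : ℤ) • 𝟙 A) hSq ⟨U, hU⟩ c hc

/-- `IsogenyPullbackPushforwardDecomposition` — `_holds` alias of `isogenyPullbackPushforwardDecomposition_holds` above under the fact's exact name (appended
2026-08-28, D-0026 bookkeeping: the proof term is the existing theorem of this file; no statement,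
definition or attribute is edited; no new named fact; the ledger's debt table listed the fact
unproved). [cite: Greither1992CyclicGalois, Ch. 0 Thm. 1.6, Lemma 1.10] -/
theorem _root_.Literature.AlgebraicGeometry.Motives.IsogenyPullbackPushforwardDecomposition_holds :
    IsogenyPullbackPushforwardDecomposition :=
  _root_.Literature.AlgebraicGeometry.Motives.AbelianVariety.isogenyPullbackPushforwardDecomposition_holds

end AbelianVariety

end Literature.AlgebraicGeometry.Motives

end
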